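/- Copyright: the b2b-balaban cell (near-miss cell 7), T⁴-continuum fan-out, ROUND-2 swarm of lineage t4-ne7b-p1
(node U5c COUNT member), seat t4-ne7b-formalise-leaf-04.  Released under the licence of the surrounding project. -/
import Summits.QuantumFields.BalabanUV.T4Continuum.Support.HistorySocket

/-!
# History constants: print's displayed per-operation shapes and the junction `Dominates` (swarm row S9 = leaf P3a)

Summits-side support leaf of the T⁴-continuum cell (rung (B)+1 on a FINITE torus only; NOT infinite volume, NOT the
mass gap, NOT the Clay statement; NOT a proof of the spine estimate NE7b).  Row S9 of the swarm claim table
`t4/b2b-balaban-t4-ne7b-p1/LEAVES-NE7b.md` (leaf P3 «constants junction» of `SKELETON-NE7b-P1.md` §2, trigger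
`t4/T4-NE7b-TRIGGER.json` conditions c2∕c6: constants SYMBOLIC, the `O(1)`'s DISPLAYED, never numerals asserted from
print).  [folklore] real arithmetic over tree declarations; no `[cite:]` tag; no `Prop`-valued fact of Bałaban's is
minted: `Dominates` is a displayed HYPOTHESIS structure on a pair (model constants, print's constants), inhabited in §6
by decided toy data and — for every positive choice of print's constants — by row S10.

WHY.  The exit over the history socket (`HistorySocket.relWeightBound_of_liveHistories`) prices a live structure `G` by
the MODEL's raw shape `e^{−credits (credit C g) G}·e^{+lifeCost (dictW R C.n₁) (cost C K R) G}` of `T4PrintedShapeBanking`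
(symbolic `C : Consts`: birth constant `a`, floor `E₂·R_n^{q′}`, size `E₃·R_n^{q′}·(d′+1)·2^{−(n−j)}`, connector class
`dC`, allowance `n₁`, profile `A₀(log g⁻²)^{p₀}`); the reading (ID)∕H3 bounds the realised factor by PRINT's per-operation
factors — [Balaban1989LargeFieldII] = B16 §1 pp. 383–387, certified as a reading (cell GAPS C-B16-6) with the constants
ledger G-B16-07: each factor a DISPLAYED SHAPE with a generic `O(1)` and the named constants `γ₀, A₁, β₀, M, d`.  This
leaf types those shapes with their `O(1)`'s as real symbols (`PrintedO1s`, §1–§2), states the SIX entrywise inequalities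
«model entry dominates print's entry at equal shape variables» as ONE Prop-structure `Dominates C O` (§3), and proves the
bookkeeping implications (§4–§5): the model's credits are entrywise BELOW print's, its cost tables entrywise ABOVE
print's, on the dictionary's own grid (`credit`, `floorK`, `sz`) — hence the raw-shape ∕ `shapeZ` domination that row S10
feeds into the socket's `price` fields.

THE PRINTED SHAPES (loci on each `def` of §2; B16 is a manuscript UNDER AUDIT — displays are LOCATED, never used as
established steps; quotations repeat `t4/T4-XREAD-NE7b-READING.md` V1–V6 and `T4PrintedShapeBanking`'s docstrings):
(i) birth credit (1.79) p. 383 ∕ p. 381 «exp(−½γ₀A₁²p₀²(g_j)(d′_j(Z_j^{(i)}) + 1) − 2p₀(g_j))» per elementary new region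
[print's own variants of the coefficient: «¼γ₀(14)^{−d}A₁²» per COMPONENT of `Z₁` after the regrouping of (1.82)
p. 385, «γ₀A₁²» in (1.85) p. 386 — cell GAPS G-t4-U5c-4; a seat reading births per component puts the (1.82)
coefficient into `O`]; (ii) renewal credit p. 386 l. 1 «the new factor exp(−p₀(g_j))» — booked verbatim by the
dictionary (`credit_kind1`), so (ii) is an identity; (iii) merger surplus p. 386 ∕ (1.87): the released amount
«2p₀(g_{j(X)}) + 2p₀(g_{j(Y)}) − 2p₀(g_{j(Z)})» IS the model's reserve of the absorbed root (`T4BankedInduction.reserve_merge`,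
§4 `surplus_identity`), print's lower estimate «≥ 2(1 + β₀)^{−1}p₀(g_{j+1})» never exceeds it at equal profile value
iff `β₀ ≥ 0`, and follows from the typed (2.7) (§4 `surplus_le_of_flow27`); (iv) floor (1.80) p. 384 with «or
d′_n(S^{n−j}(Z)) ≤ (64)^d if it is equal to 0» p. 384 [(1.81) writes the summand with an extra `d` inside its `O(1)`];
(v) size decay (1.81) p. 385, first sum; (vi) merger: connector «− O(1)2dM^dR^{d+1}_{j+1}» of (1.87) (from «d′_{j+1}(X) +
d′_{j+1}(Y) + 2d ≥ d′_{j+1}(Z)» p. 386), extension «K ≤ K₂ + n₁ + R_{j+1}» ∕ «+ O(1)2(100M)^dR^{d+2}_{j+1}» (1.88) p. 387;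
print's allowance `n₁` («e.g., n₁ < 10» p. 387) IS the grid's symbolic `C.n₁`.  Print's profile `p₀(g)` is rendered by
the model's `Setup.p0Profile C.A₀ C.p₀` ([III] (2.4) ∕ B14 (1.1) p. 246; where the amplitude `A₀` sits is the cell's
DIVERGENCE bookkeeping, not decided here): print's credits are evaluated AT THE MODEL'S PROFILE.

WHAT THIS DOES AND DOES NOT SETTLE.  It settles the CONSTANTS junction P3a: entrywise inequalities between displayed
shapes at equal shape variables, and their consequences on the dictionary's tables.  It does NOT settle the reading
(ID-a)∕H3 (cell GAPS G-ne7bp1g9-1) — WHICH printed entry is the realised cost of WHICH structure at WHICH step: that a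
renewed component, a component past its fat epoch and a merged component beyond the later horizon are small domains;
that print's step-`j` size term «O(1)M^dR_j^{d+1}d′_j(Z)» of a new region at its own birth step (first exponential of
(1.79), netted in (1.82)) is absorbed — the dictionary opens the size epoch at `j + 1` and books the size-free floor at
`j`; that print's one-time connector at the merger step `j+1` is met by the dictionary's connector epoch opening at `j+2`
(window `R_{j+2}` for `R_{j+1}`: a factor `≤ L^{d+1}` by the first member of (2.9), cell GAPS G-f2.6 RESOLVED); that
(1.88) writes `R_{j+1}^{d+1}` where (1.80) has `R_n^{d+1}` (same remark).  Those stay DISPLAYED in H3; this file compares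
entries only.  (B), BetaPertH: untouched.  NE7b NOT proved.

HONEST DEPENDENCY (cell): continuum YM on T⁴ ⇐ BetaPertH ∧ nine spine estimates (0/9 proved); BetaPertH ⇐ (D1) ∧ (D4)
∧ CAP+tail; G-an2-4 gates asym, D1 and NE2/3/4.  This file changes none of it.
-/

open Finset
open Literature.MathematicalPhysics.QuantumFieldTheory.Balaban1983to89
open T4PersistenceDictionary T4PersistentHistoryCount T4BankedInduction T4PrintedShapeBanking T4PartnerMultiplicity
open Summit.QuantumFields.BalabanUV.T4Continuum.Crowding

namespace Summit.QuantumFields.BalabanUV.T4Continuum.HistoryConstants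

noncomputable section

/-! ## §1 Print's displayed constants -/

/-- **PRINT'S DISPLAYED CONSTANTS** of B16 §1 pp. 383–387 (G-B16-07 ledger): the dimension `d`, the block constant `M`,
the named constants `γ₀` ((1.77)), `A₁` (the large-field threshold constant, ledger R4), `β₀` (of (2.6)–(2.7), in the
surplus estimate), and the FOUR generic `O(1)`'s of the displayed per-operation shapes — `o80` of the per-step cost
(1.79)∕(1.80)∕(1.83), `o81` of the fat-epoch sum (1.81), `o87` of the connector (1.87), `o88` of the extension (1.88) —
each its own real symbol (print fixes none of them; c2: no numeral is asserted). [folklore] -/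
structure PrintedO1s where
  /-- dimension `d` -/
  d : ℕ
  /-- the block constant `M` of the `M R_j`-cubes -/
  M : ℝ
  /-- `γ₀` of the lower bound (1.77) p. 383 -/
  γ₀ : ℝ
  /-- `A₁`, the large-field threshold constant (`|B(b)| ≥ g_j⁻¹δ′_j = A₁p₁(g_j)` p. 383) -/
  A₁ : ℝ
  /-- `β₀` of the flow inequalities (2.6)–(2.7), as it appears in «2(1 + β₀)^{−1}p₀(g_{j+1})» -/
  β₀ : ℝ
  /-- the `O(1)` of the per-step control cost «O(1)M^dR_n^{d+1}d′_n(·)» ((1.79), (1.80), (1.83), (1.85)–(1.88)) -/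
  o80 : ℝ
  /-- the `O(1)` of the fat-epoch sum «O(1)M^dR_n^{d+1}3(126)^d2^{−(n−j)}d′_j(Z)» ((1.81)) -/
  o81 : ℝ
  /-- the `O(1)` of the connector «O(1)2dM^dR^{d+1}_{j+1}» ((1.87)) -/
  o87 : ℝ
  /-- the `O(1)` of the per-step cost of a small domain inside a `100MR`-cube: the extension steps of (1.88) (total
  «O(1)2(100M)^dR^{d+2}_{j+1}» over `n₁ + R_{j+1} ≤ 2R_{j+1}` steps) and the renewal window («Z is a small domain, it is
  contained in a cube of the size 100MR_{j+1}, hence K = R_{j+1}» p. 386, not displayed as a formula) -/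
  o88 : ℝ

namespace PrintedO1s

/-- **POSITIVITY** of print's displayed constants (`d ≥ 1`; `β₀ ≥ 0` — «β₀ > 0 can be chosen arbitrarily small»
(2.6)). [folklore] -/
structure Pos (O : PrintedO1s) : Prop where
  /-- `d ≥ 1` -/ d_pos : 0 < O.d
  /-- `M > 0` -/ M_pos : 0 < O.M
  /-- `γ₀ > 0` -/ γ₀_pos : 0 < O.γ₀
  /-- `A₁ > 0` -/ A₁_pos : 0 < O.A₁
  /-- `β₀ ≥ 0` -/ β₀_nonneg : 0 ≤ O.β₀
  /-- `o80 > 0` -/ o80_pos : 0 < O.o80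
  /-- `o81 > 0` -/ o81_pos : 0 < O.o81
  /-- `o87 > 0` -/ o87_pos : 0 < O.o87
  /-- `o88 > 0` -/ o88_pos : 0 < O.o88

/-! ## §2 Print's displayed per-operation shapes (entry level, in the shape variables) -/

variable (O : PrintedO1s)

/-- **BIRTH CREDIT** (1.79) p. 383 ∕ p. 381: `½γ₀A₁²·P²·D + 2P` for an elementary new region of size class `D = d′+1`
at profile value `P = p₀(g_j)`. [folklore] -/
def birth (P D : ℝ) : ℝ := O.γ₀ * O.A₁ ^ 2 / 2 * P ^ 2 * D + 2 * P

/-- **RENEWAL CREDIT** p. 386 l. 1 «the new factor exp(−p₀(g_j))»: `P = p₀(g_j)`, `j` the readiness step — no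
constant of print's enters (a shape of the profile value alone). [folklore] -/
def renewal (P : ℝ) : ℝ := P

/-- **MERGER SURPLUS, print's lower estimate** (p. 386 ∕ (1.87)): `2(1+β₀)⁻¹·P`, `P = p₀(g_{j+1})`. [folklore] -/
def surplus (P : ℝ) : ℝ := 2 * (1 + O.β₀)⁻¹ * P

/-- **FLOOR** per performed step of a small domain ((1.80) p. 384 with «d′_n(S^{n−j}(Z)) ≤ (64)^d» p. 384):
`o80·M^d·64^d·ρ^{d+1}`, `ρ = R_n`. [folklore] -/
def floor (ρ : ℝ) : ℝ := O.o80 * O.M ^ O.d * 64 ^ O.d * ρ ^ (O.d + 1)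

/-- **DECAYING SIZE COST** per fat-epoch step ((1.81) p. 385, first sum): `o81·M^d·3(126)^d·ρ^{d+1}·2^{−k}·d′`,
`ρ = R_n`, `k = n − j`, `d′ = d′_j(Z)`. [folklore] -/
def size (ρ d' : ℝ) (k : ℕ) : ℝ := O.o81 * O.M ^ O.d * (3 * 126 ^ O.d) * ρ ^ (O.d + 1) * (1 / 2) ^ k * d'

/-- **CONNECTOR** of a binary merger ((1.87) p. 387): `o87·2d·M^d·ρ^{d+1}`, `ρ = R_{j+1}`. [folklore] -/
def connector (ρ : ℝ) : ℝ := O.o87 * (2 * O.d) * O.M ^ O.d * ρ ^ (O.d + 1)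

/-- **EXTENSION ∕ SMALL-DOMAIN STEP IN A `100MR`-CUBE**: `o88·(100M)^d·ρ^{d+1}` per performed step — (1.88) p. 387
displays the TOTAL «O(1)2(100M)^dR^{d+2}_{j+1}» over the `n₁ + R_{j+1} ≤ 2R_{j+1}` steps of «K ≤ K₂ + n₁ + R_{j+1}» (the
per-step cost «O(1)M^dR^{d+1}d′» of a domain inside a `100MR`-cube, `d′ ≤ 100^d`); the renewal window's steps (p. 386)
have the same shape.  The per-step entry is what the dictionary's window floor `floorK` is compared with. [folklore] -/
def extension (ρ : ℝ) : ℝ := O.o88 * (100 * O.M) ^ O.d * ρ ^ (O.d + 1)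

end PrintedO1s

/-! ## §3 The junction: `Dominates C O` — the six entrywise inequalities at the level of the constants -/

/-- **THE CONSTANTS JUNCTION** between the model tables of `T4PrintedShapeBanking` (symbolic `C : Consts`) and print's
displayed per-operation shapes (`O : PrintedO1s`): (i) birth credit (1.79) vs `credit` kind 0 — `a ≤ ½γ₀A₁²`; (ii) renewal
credit p. 386 vs kind 1 — an identity (booked verbatim); (iii) print's surplus estimate (1.87) vs the released `reserve` —
`2(1+β₀)⁻¹P ≤ 2P`; (iv) floor (1.80)∕p. 384 vs `floorK` — window power `q′ = d+1` and `o80·M^d·64^d ≤ E₂`; (v) size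
decay (1.81) vs `sz` — `o81·M^d·3(126)^d ≤ E₃`; (vi) merger extension p. 387 vs `extn`'s entries — connector class
`dC = 2d`, connector amplitude `o87·2d·M^d ≤ E₃·dC·½` (first epoch entry), extension floor `o88·(100M)^d ≤ E₂`.  Every
field is an inequality (or identification) between SYMBOLS; §4 turns them into the entrywise shape dominations, §5 into
dominations of the dictionary's tables.  A HYPOTHESIS structure: nothing of Bałaban's is asserted. [folklore] -/
structure Dominates (C : T4PrintedShapeBanking.Consts) (O : PrintedO1s) : Prop where
  /-- (i) birth credit (1.79): the model's quadratic birth constant is at most print's `½γ₀A₁²` -/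
  birth : C.a ≤ O.γ₀ * O.A₁ ^ 2 / 2
  /-- (ii) renewal credit p. 386 l. 1: the model's kind-1 credit `P` is at most print's `P` (identity) -/
  renewal : ∀ P : ℝ, 0 ≤ P → P ≤ PrintedO1s.renewal P
  /-- (iii) surplus (1.87): print's lower estimate never exceeds the model's released reserve `2P` -/
  surplus : ∀ P : ℝ, 0 ≤ P → O.surplus P ≤ 2 * P
  /-- (iv-a) window power: print's `d + 1` of (1.80) -/
  window : C.q' = O.d + 1
  /-- (iv-b) floor (1.80) with «≤ (64)^d» p. 384: `o80·M^d·64^d ≤ E₂` -/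
  floor : O.o80 * O.M ^ O.d * 64 ^ O.d ≤ C.E₂
  /-- (v) size decay (1.81): `o81·M^d·3(126)^d ≤ E₃` -/
  size : O.o81 * O.M ^ O.d * (3 * 126 ^ O.d) ≤ C.E₃
  /-- (vi-a) connector class: print's `2d` of «d′_{j+1}(X) + d′_{j+1}(Y) + 2d ≥ d′_{j+1}(Z)» p. 386 -/
  connClass : C.dC = 2 * O.d
  /-- (vi-b) connector amplitude (1.87) vs the first entry of the model's connector epoch `E₃·ρ^{q′}·dC·½` -/
  connector : O.o87 * (2 * O.d) * O.M ^ O.d ≤ C.E₃ * C.dC * (1 / 2)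
  /-- (vi-c) extension (1.88) per step (and the renewal window's steps, p. 386) vs the window floor: `o88·(100M)^d ≤ E₂` -/
  extension : O.o88 * (100 * O.M) ^ O.d ≤ C.E₂

/-! ## §4 Entry dominations (same shape variables on both sides) -/

section Entries

variable {C : T4PrintedShapeBanking.Consts} {O : PrintedO1s}

/-- (i) **BIRTH**: `a·P²·D + 2P ≤ ½γ₀A₁²·P²·D + 2P` for every profile value `P` and size class `D ≥ 0`. [folklore] -/
theorem Dominates.birth_le (hD : Dominates C O) (P : ℝ) {D : ℝ} (hDn : 0 ≤ D) :
    C.a * P ^ 2 * D + 2 * P ≤ O.birth P D := by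
  unfold PrintedO1s.birth
  have h : C.a * (P ^ 2 * D) ≤ O.γ₀ * O.A₁ ^ 2 / 2 * (P ^ 2 * D) :=
    mul_le_mul_of_nonneg_right hD.birth (by positivity)
  nlinarith [h]

/-- (ii) is `le_rfl`; (iii) holds as soon as `β₀ ≥ 0` (the content of the field `surplus`). [folklore] -/
theorem surplus_le_of_nonneg {O : PrintedO1s} (hβ : 0 ≤ O.β₀) {P : ℝ} (hP : 0 ≤ P) : O.surplus P ≤ 2 * P := by
  unfold PrintedO1s.surplus
  have h1 : (1 + O.β₀)⁻¹ ≤ 1 := inv_le_one_of_one_le₀ (by linarith)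
  nlinarith [h1, inv_nonneg.2 (show (0 : ℝ) ≤ 1 + O.β₀ by linarith)]

/-- (iv) **FLOOR**: `o80·M^d·64^d·ρ^{d+1} ≤ E₂·ρ^{q′}` for `ρ ≥ 0`. [folklore] -/
theorem Dominates.floor_le (hD : Dominates C O) {ρ : ℝ} (hρ : 0 ≤ ρ) : O.floor ρ ≤ C.E₂ * ρ ^ C.q' := by
  unfold PrintedO1s.floor
  rw [hD.window]
  exact mul_le_mul_of_nonneg_right hD.floor (by positivity)

/-- (v) **SIZE**: `o81·M^d·3(126)^d·ρ^{d+1}·2^{−k}·d′ ≤ E₃·ρ^{q′}·(d′+1)·2^{−k}` for `ρ, d′ ≥ 0` (print's `d′` against the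
model's size weight `d′ + 1`). [folklore] -/
theorem Dominates.size_le (hD : Dominates C O) (hO : O.Pos) {ρ d' : ℝ} (hρ : 0 ≤ ρ) (hd : 0 ≤ d') (k : ℕ) :
    O.size ρ d' k ≤ C.E₃ * ρ ^ C.q' * (d' + 1) * (1 / 2) ^ k := by
  unfold PrintedO1s.size
  rw [hD.window]
  have hE : 0 ≤ O.o81 * O.M ^ O.d * (3 * 126 ^ O.d) := by have := hO.o81_pos; have := hO.M_pos; positivity
  have h1 : O.o81 * O.M ^ O.d * (3 * 126 ^ O.d) * (ρ ^ (O.d + 1) * (1 / 2) ^ k * d') ≤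
      C.E₃ * (ρ ^ (O.d + 1) * (1 / 2) ^ k * d') :=
    mul_le_mul_of_nonneg_right hD.size (by positivity)
  have h2 : C.E₃ * (ρ ^ (O.d + 1) * (1 / 2) ^ k * d') ≤ C.E₃ * (ρ ^ (O.d + 1) * (1 / 2) ^ k * (d' + 1)) :=
    mul_le_mul_of_nonneg_left (mul_le_mul_of_nonneg_left (by linarith) (by positivity)) (hE.trans hD.size)
  nlinarith [h1, h2]

/-- (vi-b) **CONNECTOR**: `o87·2d·M^d·ρ^{d+1} ≤ E₃·ρ^{q′}·dC·½` for `ρ ≥ 0`. [folklore] -/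
theorem Dominates.connector_le (hD : Dominates C O) {ρ : ℝ} (hρ : 0 ≤ ρ) :
    O.connector ρ ≤ C.E₃ * ρ ^ C.q' * C.dC * (1 / 2) ^ (1 : ℕ) := by
  unfold PrintedO1s.connector
  rw [hD.window, pow_one]
  have h := mul_le_mul_of_nonneg_right hD.connector (show 0 ≤ ρ ^ (O.d + 1) by positivity)
  nlinarith [h]

/-- (vi-c) **EXTENSION**: `o88·(100M)^d·ρ^{d+1} ≤ E₂·ρ^{q′}` for `ρ ≥ 0`. [folklore] -/
theorem Dominates.extension_le (hD : Dominates C O) {ρ : ℝ} (hρ : 0 ≤ ρ) : O.extension ρ ≤ C.E₂ * ρ ^ C.q' := by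
  unfold PrintedO1s.extension
  rw [hD.window]
  exact mul_le_mul_of_nonneg_right hD.extension (by positivity)

/-- **(iii) IN PRINT'S OWN FORM**: the released amount of a binary merger — the absorbed root's reserve — satisfies
«2p₀(g_{j(X)}) + 2p₀(g_{j(Y)}) − 2p₀(g_{j(Z)})» `= reserve (absorbed)` (p. 386; `T4BankedInduction.reserve_merge` by name).
[folklore] -/
theorem surplus_identity (C : T4PrintedShapeBanking.Consts) (g : ℕ → ℝ) (X Y : Gen PEv) (e : PEv) :
    reserve C g X.root + reserve C g Y.root - reserve C g (Gen.merge X Y e).root = reserve C g (absorbed X Y) := by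
  have h := reserve_merge (reserve C g) X Y e; linarith

/-- **… AND PRINT'S LOWER ESTIMATE FROM THE TYPED (2.7)**: along a run obeying `B14.FlowIneq27 g β′ β₀ p K`, for
`j ≤ s ≤ K` and `A₀ ≥ 0`, `(1+β₀)⁻¹·A₀(log g_s⁻²)^p ≤ A₀(log g_j⁻²)^p` — the sentence «hence 2p₀(g_{j(X)}) + … ≥
2(1 + β₀)^{−1}p₀(g_{j+1})» p. 386 with `j = j(X) ≤ j+1 = s`. [folklore] -/
theorem surplus_le_of_flow27 {g : ℕ → ℝ} {β' β₀ : ℝ} {p K : ℕ} (h27 : B14.FlowIneq27 g β' β₀ p K) (hβ : 0 ≤ β₀)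
    {A₀ : ℝ} (hA : 0 ≤ A₀) {j s : ℕ} (hjs : j ≤ s) (hs : s ≤ K) (hx : 0 ≤ Real.log ((g s) ^ 2)⁻¹) :
    (1 + β₀)⁻¹ * p0Profile A₀ p (g s) ≤ p0Profile A₀ p (g j) := by
  have hb : 0 < 1 + β₀ := by linarith
  unfold p0Profile
  rw [inv_mul_le_iff₀ hb]
  rcases Nat.lt_or_ge j s with hlt | hge
  · have h := (h27 j s hlt hs).1
    nlinarith [mul_le_mul_of_nonneg_left h hA]
  · have hjs' : j = s := le_antisymm hjs hge
    subst hjs'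
    have hy : 0 ≤ A₀ * (Real.log ((g j) ^ 2)⁻¹) ^ p := mul_nonneg hA (pow_nonneg hx _)
    nlinarith [hy]

end Entries

/-! ## §5 On the persistence dictionary's tables -/

section Tables

variable {C : T4PrintedShapeBanking.Consts} {O : PrintedO1s}

/-- **PRINT'S CREDIT TABLE ON THE DICTIONARY'S EVENTS**, at the model's profile: a birth `(j, 0, d′)` carries
`½γ₀A₁²·p₀(g_j)²·(d′+1) + 2p₀(g_j)` ((1.79)), a renewal at step `h+1` carries `p₀(g_h)` (p. 386), a merger `0`. [folklore] -/
def pcredit (O : PrintedO1s) (C : T4PrintedShapeBanking.Consts) (g : ℕ → ℝ) (e : PEv) : ℝ :=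
  if e.kind = 0 then O.birth (p0Profile C.A₀ C.p₀ (g e.step)) ((e.fat : ℝ) + 1)
  else if e.kind = 1 then PrintedO1s.renewal (p0Profile C.A₀ C.p₀ (g (e.step - 1))) else 0

/-- print's credit of a birth [folklore] -/
theorem pcredit_kind0 {g : ℕ → ℝ} {e : PEv} (h : e.kind = 0) :
    pcredit O C g e = O.γ₀ * O.A₁ ^ 2 / 2 * p0Profile C.A₀ C.p₀ (g e.step) ^ 2 * ((e.fat : ℝ) + 1) +
      2 * p0Profile C.A₀ C.p₀ (g e.step) := by
  simp [pcredit, h, PrintedO1s.birth]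

/-- print's credit of a renewal [folklore] -/
theorem pcredit_kind1 {g : ℕ → ℝ} {e : PEv} (h : e.kind = 1) :
    pcredit O C g e = p0Profile C.A₀ C.p₀ (g (e.step - 1)) := by
  simp [pcredit, h, PrintedO1s.renewal]

/-- print's credit of a merger is `0` (the surplus is a re-booking of reserves, §4 `surplus_identity`) [folklore] -/
theorem pcredit_kind2 {g : ℕ → ℝ} {e : PEv} (h : e.kind = 2) : pcredit O C g e = 0 := by
  simp [pcredit, h]

/-- **THE MODEL'S CREDIT IS ENTRYWISE BELOW PRINT'S** (every event, every run). [folklore] -/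
theorem Dominates.credit_le (hD : Dominates C O) (g : ℕ → ℝ) (e : PEv) : credit C g e ≤ pcredit O C g e := by
  by_cases h0 : e.kind = 0
  · rw [credit_kind0 h0, pcredit_kind0 h0]
    exact hD.birth_le _ (by positivity)
  · by_cases h1 : e.kind = 1
    · rw [credit_kind1 h1, pcredit_kind1 h1]
    · have h2 : e.kind = 2 := by
        generalize hk : e.kind = k at h0 h1 ⊢
        fin_cases k <;> simp_all
      rw [credit_kind2 h2, pcredit_kind2 h2]

/-- **… HENCE FOR EVERY GENEALOGY** `credits (credit C g) G ≤ credits (pcredit O C g) G`. [folklore] -/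
theorem Dominates.credits_le (hD : Dominates C O) (g : ℕ → ℝ) (G : Gen PEv) :
    credits (credit C g) G ≤ credits (pcredit O C g) G :=
  Finset.sum_le_sum fun e _ => hD.credit_le g e

/-- **PRINT'S FLOOR IS BELOW THE MODEL'S FLOOR** at every performed step `n ≤ K` (`ρ = R_n`). [folklore] -/
theorem Dominates.floor_le_floorK (hD : Dominates C O) {K : ℕ} (R : ℕ → ℕ) {n : ℕ} (hn : n ≤ K) :
    O.floor (R n) ≤ floorK C K R n := by
  unfold floorK; rw [if_pos hn]
  exact hD.floor_le (Nat.cast_nonneg _)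

/-- **PRINT'S EXTENSION STEP IS BELOW THE MODEL'S FLOOR** at every performed step (the merger window books `floorK`).
[folklore] -/
theorem Dominates.extension_le_floorK (hD : Dominates C O) {K : ℕ} (R : ℕ → ℕ) {n : ℕ} (hn : n ≤ K) :
    O.extension (R n) ≤ floorK C K R n := by
  unfold floorK; rw [if_pos hn]
  exact hD.extension_le (Nat.cast_nonneg _)

/-- **PRINT'S FAT-EPOCH SIZE COST IS BELOW THE MODEL'S `sz`** for a birth event at every performed step of its size epoch
(`k = n − j`, print's `d′` = the event's fatness class). [folklore] -/
theorem Dominates.size_le_sz (hD : Dominates C O) (hO : O.Pos) {K : ℕ} (R : ℕ → ℕ) {e : PEv} (he : e.kind = 0)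
    {n : ℕ} (hn : n ∈ supp C e) (hnK : n ≤ K) :
    O.size (R n) (e.fat : ℝ) (n - e.step) ≤ sz C K R e n := by
  unfold sz; rw [if_pos ⟨hn, hnK⟩, wt_kind0 he]
  exact hD.size_le hO (Nat.cast_nonneg _) (Nat.cast_nonneg _) _

/-- **PRINT'S CONNECTOR IS BELOW THE FIRST ENTRY OF THE MODEL'S CONNECTOR EPOCH** of a merger event (the epoch opens
one step after the merger step; performed steps only). [folklore] -/
theorem Dominates.connector_le_sz (hD : Dominates C O) {K : ℕ} (R : ℕ → ℕ) {e : PEv} (he : e.kind = 2)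
    (hK : e.step + 1 ≤ K) : O.connector (R (e.step + 1)) ≤ sz C K R e (e.step + 1) := by
  have hmem : e.step + 1 ∈ supp C e := by
    simp only [supp, fw_kind2 he, Finset.mem_Ioc]
    exact ⟨Nat.lt_succ_self _, Nat.add_le_add_left (le_max_left 1 _) _⟩
  unfold sz; rw [if_pos ⟨hmem, hK⟩, wt_kind2 he, Nat.add_sub_cancel_left]
  exact hD.connector_le (Nat.cast_nonneg _)

/-- **LIFE COSTS ARE MONOTONE IN THE PER-STEP COST** on the life (the tool by which a realised per-step cost read below
`cost C K R G ·` — reading (ID-a) — is priced by the model's `lifeCost`). [folklore] -/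
theorem lifeCost_mono {W : PEv → ℕ} {κ κ' : Gen PEv → ℕ → ℝ} {G : Gen PEv}
    (h : ∀ n ∈ life W G, κ G n ≤ κ' G n) : lifeCost W κ G ≤ lifeCost W κ' G :=
  Finset.sum_le_sum h

/-- **RAW-SHAPE DOMINATION**: under `Dominates`, a raw factor priced by PRINT's credits and by any per-step cost read
below the model's `cost` is below the MODEL's raw shape `e^{−credits}·e^{+lifeCost}`. [folklore] -/
theorem Dominates.rawShape_le (hD : Dominates C O) {K : ℕ} {R : ℕ → ℕ} (g : ℕ → ℝ) {κ : Gen PEv → ℕ → ℝ}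
    {G : Gen PEv} (h : ∀ n ∈ life (dictW R C.n₁) G, κ G n ≤ cost C K R G n) :
    Real.exp (-credits (pcredit O C g) G) * Real.exp (lifeCost (dictW R C.n₁) κ G) ≤
      Real.exp (-credits (credit C g) G) * Real.exp (lifeCost (dictW R C.n₁) (cost C K R) G) :=
  mul_le_mul (Real.exp_le_exp.2 (neg_le_neg (hD.credits_le g G))) (Real.exp_le_exp.2 (lifeCost_mono h))
    (Real.exp_pos _).le (Real.exp_pos _).le

/-- **… AND WITH THE MULTIPLICITY FACTOR: BELOW `shapeZ`** (the right-hand side of the socket's `price` fields), for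
`Kz ≥ 1`, `σ ≥ 0`, `Λ′ ≥ 0`. [folklore] -/
theorem Dominates.shape_le_shapeZ (hD : Dominates C O) {Kz p σ Λ' : ℝ} (hKz : 1 ≤ Kz) (hσ : 0 ≤ σ) (hΛ : 0 ≤ Λ')
    (R : ℕ → ℕ → ℕ) (g : ℕ → ℕ → ℝ) (K : ℕ) {κ : Gen PEv → ℕ → ℝ} {G : Gen PEv}
    (h : ∀ n ∈ life (dictW (R K) C.n₁) G, κ G n ≤ cost C K (R K) G n) :
    Kz ^ (merges G).card * (∏ e ∈ merges G, Crowding.Q (wcnt G) σ e.step ^ p) * Λ' ^ partnerAges PEv.step G *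
        (Real.exp (-credits (pcredit O C (g K)) G) * Real.exp (lifeCost (dictW (R K) C.n₁) κ G)) ≤
      HistorySocket.shapeZ C Kz p σ Λ' R g K G := by
  unfold HistorySocket.shapeZ
  refine mul_le_mul_of_nonneg_left (hD.rawShape_le (g K) h) ?_
  refine mul_nonneg (mul_nonneg (pow_nonneg (zero_le_one.trans hKz) _) (prod_nonneg fun e he => ?_))
    (pow_nonneg hΛ _)
  exact Real.rpow_nonneg (zero_le_one.trans (one_le_Qw_of_mem hσ he)) _

end Tables

/-! ## §6 Sanity: a decided instance (TOY symbols, not print's values) -/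

namespace Sanity

/-- toy printed constants `(d, M, γ₀, A₁, β₀, o80, o81, o87, o88) = (1, 1, 2, 1, 0, 1, 1, 1, 1)` [folklore] -/
def O₁ : PrintedO1s := ⟨1, 1, 2, 1, 0, 1, 1, 1, 1⟩

/-- toy model constants dominating `O₁`: `(n₁, dC, q′, E₂, E₃, κ₁, E₀, Eb, μ, a, A₀, p₀) = (2, 2, 2, 100, 378, 0, 0, 0, 0,
1, 1, 7)` [folklore] -/
def C₁ : T4PrintedShapeBanking.Consts := ⟨2, 2, 2, 100, 378, 0, 0, 0, 0, 1, 1, 7⟩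

/-- the toy printed constants are positive [folklore] -/
theorem O₁_pos : O₁.Pos := by constructor <;> norm_num [O₁]

/-- the toy model constants are valid (`fatWait 2 = 1 ≤ n₁ = 2`) [folklore] -/
theorem C₁_valid : C₁.Valid :=
  ⟨by norm_num [C₁], by norm_num [C₁], by norm_num [C₁], by norm_num [C₁], by norm_num [C₁], by norm_num [C₁], by decide⟩

/-- **`Dominates` IS DECIDED ON THE TOY PAIR**: `64 ≤ 100`, `378 ≤ 378`, `2 ≤ 378`, `100 ≤ 100`, `1 ≤ 1`, `2 = 1 + 1`,
`2 = 2·1`. [folklore] -/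
theorem dominates_C₁_O₁ : Dominates C₁ O₁ where
  birth := by norm_num [C₁, O₁]
  renewal P _ := le_of_eq rfl
  surplus P hP := surplus_le_of_nonneg (by norm_num [O₁]) hP
  window := by norm_num [C₁, O₁]
  floor := by norm_num [C₁, O₁]
  size := by norm_num [C₁, O₁]
  connClass := by norm_num [C₁, O₁]
  connector := by norm_num [C₁, O₁]
  extension := by norm_num [C₁, O₁]

end Sanity

end

end Summit.QuantumFields.BalabanUV.T4Continuum.HistoryConstants
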